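import Summits.QuantumFields.BalabanUV.Beta.ResolventFinCertificate
import Summits.QuantumFields.BalabanUV.Beta.ResolventBoxCertificateTaylor

/-!
# Beta / ResolventFinCertificateTaylor — THE ORDER-m SOCKET OF THE FIN CERTIFICATE: a `(τ, x)`-dependent preconditioner and the closed-form
# order-m TAYLOR TAIL of a stencil family along a fin (β sub-cell, BINDER-OWNERS row CAP-k, lineage `b2b-balaban-beta-an5`, gen 25; node
# BETA-an5-g25-FINS, leaf 2c — parity of the fin sockets with the box sockets of `ResolventBoxCertificateTaylor`)

`ResolventFinCertificate.fin_certificate` (leaf 2a, p225122) is the ORDER-0 fin leaf (constant preconditioner + first-order Lipschitz majorant).  The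
engines that will certify the (Z2a) quarter-region cover work at ORDER m (Taylor models; cap1-g10: `m = 8`, `h ≈ 0.1–0.25`; the order-0 box leaf needs
`h ≤ 2·10⁻⁵` at the worst corner — `ResolventBoxCertificateTaylor` docstring).  For «(W) by the SAME leaf code as (Z2a)» (census v1.6 V27) to hold at
the socket level, this module is the fin twin of `ResolventBoxCertificateTaylor` §1–§3:

* §1 the FIN RATE `finRate R i σ c = R_i σ + Σ_k R_{succAbove i k} c_k` and the COMPLEX FIN INCREMENT
  `finIncr = −(τ − τ₀)·r + i·R_i·(x − x₀)` between the rectangle's centre `(τ₀, x₀)` and `(τ, x)`: `χ_R(p(τ,x)) = χ_R(p(τ₀,x₀))·e^{finIncr}`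
  (`character_fin_eq_mul_exp_finIncr`), `‖finIncr‖ ≤ |r|·h_τ + |R_i|·h_x` on the rectangle (`norm_finIncr_le`), `‖χ_R(p(τ₀,x₀))‖ = e^{−τ₀ r}`.
* §2 the ORDER-m TAYLOR CHARACTER ∕ FAMILY along the fin (`charTaylorFin`, `taylorFamilyFin`: `e^{finIncr}` replaced by `Σ_{k<m} finIncr^k∕k!` — a
  polynomial in the two REAL rectangle displacements `(τ − τ₀, x − x₀)`, which is what a two-variable Taylor-model engine evaluates) and the CLOSED-FORM
  TAIL `taylorTailFin m S K i σ c τ₀ h_τ h_x = Σ_R e^{−τ₀ r_R}·tailFactor m (|r_R|·h_τ + |R_i|·h_x)·‖K[R]‖` (`norm_characterSum_fin_sub_taylorFamilyFin_le`;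
  Mathlib's `Complex.exp_bound` for the COMPLEX increment, `‖finIncr‖ ≤ 1` on the support) — a NUMBER from the typed tables; `m = 1` is leaf 2a's
  Lipschitz majorant up to the factor 2.
* §3 `fin_certificate_of_residual` (Krawczyk pointwise on the rectangle with a `(τ,x)`-dependent preconditioner) and **`fin_certificate_taylor`** — the
  ORDER-m FIN LEAF: engine data `P(τ,x)` with sup `p`, residual `‖1 − P·taylorFamilyFin‖ ≤ ε` on the rectangle, kernel tail, checks
  `ε + p·taylorTailFin ≤ θ < 1` ⟹ `IsUnit (A p).det ∧ ‖(A p)⁻¹‖ ≤ p∕(1−θ)` at every fin point of the rectangle — the per-rectangle conclusion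
  `CapRouteAFins.…_ofReflect_ofFinRects` consumes (`IsUnit det`; the norm bound is free).

HONEST FRAMING.  Kernel glue ([folklore]); no rectangle, no preconditioner, no number supplied; no fin certificate exists; 0 binders instantiated.  As
for the box socket, the COLLECTED coefficients of the residual polynomial `1 − P·T` are the engines' arithmetic (two implementations) and enter as `ε`.
Discharging `BetaPertH` would make Bałaban's ultraviolet stability unconditional — NOT the continuum limit, NOT the Clay problem.  0 `sorry`, 0 cite tags.
-/

namespace Summit.QuantumFields.BalabanUV.Beta.ResolventFinCertificate

open Complex Set Matrix Finset
open Summit.QuantumFields.BalabanUV.Beta.PolyRegularAlgebra (character)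
open Summit.QuantumFields.BalabanUV.Beta.ResolventBoxCertificate (krawczyk tailFactor tailFactor_mono)
open scoped Real Matrix.Norms.L2Operator

noncomputable section

variable {d : ℕ} {n : Type*} [Fintype n] [DecidableEq n]

/-! ## §1 The fin rate and the complex fin increment -/

omit [Fintype n] [DecidableEq n] in
/-- THE FIN RATE of the frequency `R` on the fin at coordinate `i`, slope `σ`, through `i·c`: `r = R_i σ + Σ_k R_{succAbove i k} c_k` (the decay
exponent of `χ_R` along the fin: `‖χ_R(p(τ,x))‖ = e^{−τ r}`). [folklore] -/
def finRate (R : Fin (d + 1) → ℤ) (i : Fin (d + 1)) (σ : ℝ) (c : Fin d → ℝ) : ℝ := R i * σ + ∑ k, (R (i.succAbove k) : ℝ) * c k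

omit [Fintype n] [DecidableEq n] in
/-- `character_fin` in terms of the fin rate. [folklore] -/
theorem character_fin' (R : Fin (d + 1) → ℤ) (i : Fin (d + 1)) (σ : ℝ) (c : Fin d → ℝ) (τ x : ℝ) :
    character R (i.insertNth ((x : ℂ) + ((τ * σ : ℝ) : ℂ) * I) fun j => ((τ * c j : ℝ) : ℂ) * I)
      = (Real.exp (-(τ * finRate R i σ c)) : ℂ) * cexp (I * ((R i * x : ℝ) : ℂ)) :=
  character_fin R i σ c τ x

omit [Fintype n] [DecidableEq n] in
/-- the norm of a character at a fin point: `e^{−τ r}`. [folklore] -/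
theorem norm_character_fin_eq (R : Fin (d + 1) → ℤ) (i : Fin (d + 1)) (σ : ℝ) (c : Fin d → ℝ) (τ x : ℝ) :
    ‖character R (i.insertNth ((x : ℂ) + ((τ * σ : ℝ) : ℂ) * I) fun j => ((τ * c j : ℝ) : ℂ) * I)‖ = Real.exp (-(τ * finRate R i σ c)) := by
  rw [character_fin', norm_mul, Complex.norm_real, Real.norm_of_nonneg (Real.exp_pos _).le, Complex.norm_exp_I_mul_ofReal, mul_one]

omit [Fintype n] [DecidableEq n] in
/-- THE COMPLEX FIN INCREMENT between the centre `(τ₀, x₀)` and `(τ, x)`: `−(τ − τ₀)·r + i·R_i·(x − x₀)`. [folklore] -/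
def finIncr (R : Fin (d + 1) → ℤ) (i : Fin (d + 1)) (σ : ℝ) (c : Fin d → ℝ) (τ₀ x₀ τ x : ℝ) : ℂ :=
  ((-((τ - τ₀) * finRate R i σ c) : ℝ) : ℂ) + I * ((R i * (x - x₀) : ℝ) : ℂ)

omit [Fintype n] [DecidableEq n] in
/-- `χ_R(p(τ,x)) = χ_R(p(τ₀,x₀)) · e^{finIncr}`. [folklore] -/
theorem character_fin_eq_mul_exp_finIncr (R : Fin (d + 1) → ℤ) (i : Fin (d + 1)) (σ : ℝ) (c : Fin d → ℝ) (τ₀ x₀ τ x : ℝ) :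
    character R (i.insertNth ((x : ℂ) + ((τ * σ : ℝ) : ℂ) * I) fun j => ((τ * c j : ℝ) : ℂ) * I)
      = character R (i.insertNth ((x₀ : ℂ) + ((τ₀ * σ : ℝ) : ℂ) * I) fun j => ((τ₀ * c j : ℝ) : ℂ) * I)
          * cexp (finIncr R i σ c τ₀ x₀ τ x) := by
  rw [character_fin', character_fin', Complex.ofReal_exp, Complex.ofReal_exp, ← Complex.exp_add, ← Complex.exp_add, ← Complex.exp_add]
  congr 1
  simp only [finIncr]
  push_cast
  ring

omit [Fintype n] [DecidableEq n] in
/-- on the fin rectangle `|τ − τ₀| ≤ h_τ`, `|x − x₀| ≤ h_x`: `‖finIncr‖ ≤ |r|·h_τ + |R_i|·h_x`. [folklore] -/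
theorem norm_finIncr_le (R : Fin (d + 1) → ℤ) (i : Fin (d + 1)) (σ : ℝ) (c : Fin d → ℝ) {τ₀ x₀ τ x hτ hx : ℝ}
    (hτ' : |τ - τ₀| ≤ hτ) (hx' : |x - x₀| ≤ hx) :
    ‖finIncr R i σ c τ₀ x₀ τ x‖ ≤ |finRate R i σ c| * hτ + |(R i : ℝ)| * hx := by
  unfold finIncr
  refine (norm_add_le _ _).trans (add_le_add ?_ ?_)
  · rw [Complex.norm_real, Real.norm_eq_abs, abs_neg, abs_mul, mul_comm]
    exact mul_le_mul_of_nonneg_left hτ' (abs_nonneg _)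
  · rw [norm_mul, Complex.norm_I, one_mul, Complex.norm_real, Real.norm_eq_abs, abs_mul]
    exact mul_le_mul_of_nonneg_left hx' (abs_nonneg _)

/-! ## §2 The order-m Taylor family along the fin and its closed-form tail -/

omit [Fintype n] [DecidableEq n] in
/-- THE ORDER-m TAYLOR CHARACTER along the fin: `χ_R(p(τ₀,x₀)) · Σ_{k<m} finIncr^k ∕ k!`. [folklore] -/
def charTaylorFin (m : ℕ) (R : Fin (d + 1) → ℤ) (i : Fin (d + 1)) (σ : ℝ) (c : Fin d → ℝ) (τ₀ x₀ τ x : ℝ) : ℂ :=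
  character R (i.insertNth ((x₀ : ℂ) + ((τ₀ * σ : ℝ) : ℂ) * I) fun j => ((τ₀ * c j : ℝ) : ℂ) * I)
    * ∑ k ∈ range m, finIncr R i σ c τ₀ x₀ τ x ^ k / (k.factorial : ℂ)

/-- THE ORDER-m TAYLOR FAMILY of the stencil family along the fin, around the centre `(τ₀, x₀)`. [folklore] -/
def taylorFamilyFin (m : ℕ) (S : Finset (Fin (d + 1) → ℤ)) (K : (Fin (d + 1) → ℤ) → Matrix n n ℂ)
    (i : Fin (d + 1)) (σ : ℝ) (c : Fin d → ℝ) (τ₀ x₀ τ x : ℝ) : Matrix n n ℂ :=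
  ∑ R ∈ S, charTaylorFin m R i σ c τ₀ x₀ τ x • K R

omit [Fintype n] [DecidableEq n] in
/-- ONE CHARACTER: `‖χ_R(p(τ,x)) − charTaylorFin m …‖ ≤ e^{−τ₀ r} · tailFactor m ‖finIncr‖` when `‖finIncr‖ ≤ 1`, `0 < m`. [folklore] -/
theorem norm_character_fin_sub_charTaylorFin_le {m : ℕ} (hm : 0 < m) (R : Fin (d + 1) → ℤ) (i : Fin (d + 1)) (σ : ℝ)
    (c : Fin d → ℝ) {τ₀ x₀ τ x : ℝ} (ht : ‖finIncr R i σ c τ₀ x₀ τ x‖ ≤ 1) :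
    ‖character R (i.insertNth ((x : ℂ) + ((τ * σ : ℝ) : ℂ) * I) fun j => ((τ * c j : ℝ) : ℂ) * I) - charTaylorFin m R i σ c τ₀ x₀ τ x‖
      ≤ Real.exp (-(τ₀ * finRate R i σ c)) * tailFactor m ‖finIncr R i σ c τ₀ x₀ τ x‖ := by
  rw [character_fin_eq_mul_exp_finIncr R i σ c τ₀ x₀ τ x, charTaylorFin, ← mul_sub, norm_mul, norm_character_fin_eq]
  refine mul_le_mul_of_nonneg_left ?_ (Real.exp_pos _).le
  have hb := Complex.exp_bound ht hm
  simpa [tailFactor] using hb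

/-- THE CLOSED-FORM ORDER-m TAIL of the stencil family on the fin rectangle of half-widths `(h_τ, h_x)` centred at `τ₀`. [folklore] -/
def taylorTailFin (m : ℕ) (S : Finset (Fin (d + 1) → ℤ)) (K : (Fin (d + 1) → ℤ) → Matrix n n ℂ)
    (i : Fin (d + 1)) (σ : ℝ) (c : Fin d → ℝ) (τ₀ hτ hx : ℝ) : ℝ :=
  ∑ R ∈ S, Real.exp (-(τ₀ * finRate R i σ c)) * tailFactor m (|finRate R i σ c| * hτ + |(R i : ℝ)| * hx) * ‖K R‖

/-- **THE ORDER-m TAYLOR TAIL ON A FIN RECTANGLE**: for `|τ − τ₀| ≤ h_τ`, `|x − x₀| ≤ h_x`, `0 < m`, and `|r_R|·h_τ + |R_i|·h_x ≤ 1` on the support,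
`‖Σ_R χ_R(p(τ,x))K[R] − taylorFamilyFin m … τ x‖ ≤ taylorTailFin m S K i σ c τ₀ h_τ h_x`. [folklore] -/
theorem norm_characterSum_fin_sub_taylorFamilyFin_le {m : ℕ} (hm : 0 < m) (S : Finset (Fin (d + 1) → ℤ))
    (K : (Fin (d + 1) → ℤ) → Matrix n n ℂ) (i : Fin (d + 1)) (σ : ℝ) (c : Fin d → ℝ) {τ₀ x₀ τ x hτ hx : ℝ}
    (hτ' : |τ - τ₀| ≤ hτ) (hx' : |x - x₀| ≤ hx) (hsmall : ∀ R ∈ S, |finRate R i σ c| * hτ + |(R i : ℝ)| * hx ≤ 1) :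
    ‖(∑ R ∈ S, character R (i.insertNth ((x : ℂ) + ((τ * σ : ℝ) : ℂ) * I) fun j => ((τ * c j : ℝ) : ℂ) * I) • K R)
        - taylorFamilyFin m S K i σ c τ₀ x₀ τ x‖ ≤ taylorTailFin m S K i σ c τ₀ hτ hx := by
  rw [taylorFamilyFin, ← Finset.sum_sub_distrib, taylorTailFin]
  refine (norm_sum_le _ _).trans (Finset.sum_le_sum fun R hR => ?_)
  rw [← sub_smul]
  refine (norm_smul_le _ _).trans ?_
  have hincr := norm_finIncr_le R i σ c hτ' hx'
  have h1 := norm_character_fin_sub_charTaylorFin_le hm R i σ c (hincr.trans (hsmall R hR))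
  refine mul_le_mul_of_nonneg_right (h1.trans ?_) (norm_nonneg _)
  exact mul_le_mul_of_nonneg_left (tailFactor_mono m (norm_nonneg _) hincr) (Real.exp_pos _).le

/-! ## §3 The residual socket and the order-m leaf on a fin rectangle -/

variable {A : (Fin (d + 1) → ℂ) → Matrix n n ℂ}

/-- **RESIDUAL SOCKET ON A FIN RECTANGLE**: a preconditioner family `P(τ,x)` with `‖1 − P·A(p(τ,x))‖ ≤ θ < 1` and `‖P‖ ≤ p` on the rectangle
⟹ `IsUnit (A p).det ∧ ‖(A p)⁻¹‖ ≤ p∕(1−θ)` at every fin point of the rectangle. [folklore] -/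
theorem fin_certificate_of_residual (i : Fin (d + 1)) (σ : ℝ) (c : Fin d → ℝ) {τ₀ x₀ hτ hx : ℝ} {P : ℝ → ℝ → Matrix n n ℂ}
    {θ p : ℝ}
    (hres : ∀ τ x : ℝ, |τ - τ₀| ≤ hτ → |x - x₀| ≤ hx →
      ‖1 - P τ x * A (i.insertNth ((x : ℂ) + ((τ * σ : ℝ) : ℂ) * I) fun j => ((τ * c j : ℝ) : ℂ) * I)‖ ≤ θ)
    (hθ1 : θ < 1) (hP : ∀ τ x : ℝ, |τ - τ₀| ≤ hτ → |x - x₀| ≤ hx → ‖P τ x‖ ≤ p) :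
    ∀ τ x : ℝ, |τ - τ₀| ≤ hτ → |x - x₀| ≤ hx →
      IsUnit (A (i.insertNth ((x : ℂ) + ((τ * σ : ℝ) : ℂ) * I) fun j => ((τ * c j : ℝ) : ℂ) * I)).det ∧
        ‖(A (i.insertNth ((x : ℂ) + ((τ * σ : ℝ) : ℂ) * I) fun j => ((τ * c j : ℝ) : ℂ) * I))⁻¹‖ ≤ p / (1 - θ) := by
  intro τ x hτ' hx'
  obtain ⟨hU, hN⟩ := krawczyk (hres τ x hτ' hx') hθ1
  exact ⟨hU, hN.trans (div_le_div_of_nonneg_right (hP τ x hτ' hx') (by linarith))⟩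

/-- **THE ORDER-m FIN CERTIFICATE** (one leaf).  ENGINE DATA: a preconditioner family `P(τ,x)` (typically the order-m Taylor polynomial of `A(p)⁻¹`
at the centre in the rectangle displacements), its sup `p` on the rectangle, and the bound `ε` of the RESIDUAL AGAINST THE TAYLOR FAMILY
`‖1 − P(τ,x)·taylorFamilyFin m S K i σ c τ₀ x₀ τ x‖` on the rectangle; KERNEL: the tail `taylorTailFin`; CHECKS: `ε + p·taylorTailFin ≤ θ < 1`.
THEN at every fin point of the rectangle `IsUnit (A p).det ∧ ‖(A p)⁻¹‖ ≤ p∕(1−θ)` for `A q = Σ_{R∈S} χ_q(R)·K[R]` — the per-rectangle conclusion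
of `of_fin_cover` ∕ `CapRouteAFins.…_ofReflect_ofFinRects`. [folklore] -/
theorem fin_certificate_taylor {m : ℕ} (hm : 0 < m) (S : Finset (Fin (d + 1) → ℤ)) (K : (Fin (d + 1) → ℤ) → Matrix n n ℂ)
    (i : Fin (d + 1)) (σ : ℝ) (c : Fin d → ℝ) {τ₀ x₀ hτ hx : ℝ}
    (hsmall : ∀ R ∈ S, |finRate R i σ c| * hτ + |(R i : ℝ)| * hx ≤ 1)
    {P : ℝ → ℝ → Matrix n n ℂ} {ε p θ : ℝ}
    (hE : ∀ τ x : ℝ, |τ - τ₀| ≤ hτ → |x - x₀| ≤ hx → ‖1 - P τ x * taylorFamilyFin m S K i σ c τ₀ x₀ τ x‖ ≤ ε)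
    (hP : ∀ τ x : ℝ, |τ - τ₀| ≤ hτ → |x - x₀| ≤ hx → ‖P τ x‖ ≤ p) (hp : 0 ≤ p)
    (hθ : ε + p * taylorTailFin m S K i σ c τ₀ hτ hx ≤ θ) (hθ1 : θ < 1) :
    ∀ τ x : ℝ, |τ - τ₀| ≤ hτ → |x - x₀| ≤ hx →
      IsUnit (∑ R ∈ S, character R (i.insertNth ((x : ℂ) + ((τ * σ : ℝ) : ℂ) * I) fun j => ((τ * c j : ℝ) : ℂ) * I) • K R).det ∧
        ‖(∑ R ∈ S, character R (i.insertNth ((x : ℂ) + ((τ * σ : ℝ) : ℂ) * I) fun j => ((τ * c j : ℝ) : ℂ) * I) • K R)⁻¹‖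
          ≤ p / (1 - θ) := by
  refine fin_certificate_of_residual (A := fun q => ∑ R ∈ S, character R q • K R) i σ c (fun τ x hτ' hx' => ?_) hθ1 hP
  set T := ∑ R ∈ S, character R (i.insertNth ((x : ℂ) + ((τ * σ : ℝ) : ℂ) * I) fun j => ((τ * c j : ℝ) : ℂ) * I) • K R with hT
  set F := taylorFamilyFin m S K i σ c τ₀ x₀ τ x with hF
  have e : (1 : Matrix n n ℂ) - P τ x * T = (1 - P τ x * F) - P τ x * (T - F) := by rw [Matrix.mul_sub]; abel
  rw [e]
  calc ‖(1 - P τ x * F) - P τ x * (T - F)‖ ≤ ‖1 - P τ x * F‖ + ‖P τ x * (T - F)‖ := norm_sub_le _ _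
    _ ≤ ε + ‖P τ x‖ * ‖T - F‖ := add_le_add (hE τ x hτ' hx') (l2_opNorm_mul _ _)
    _ ≤ ε + p * taylorTailFin m S K i σ c τ₀ hτ hx := by
        gcongr
        · exact hP τ x hτ' hx'
        · exact norm_characterSum_fin_sub_taylorFamilyFin_le hm S K i σ c hτ' hx' hsmall
    _ ≤ θ := hθ

end

end Summit.QuantumFields.BalabanUV.Beta.ResolventFinCertificate
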